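import Mathlib
import HarnessLib
import Summits.NavierStokesRegularity.NavierStokesRegularity.Theorems.PoloidalWindowDoorLrcModEntireAxisKinematics
import Summits.NavierStokesRegularity.NavierStokesRegularity.Theorems.PoloidalWindowDoorPoloidalWindowRigiditySymmetryGerms

/-!
# Route `PoloidalWindowDoor`, item `LrcModEntire` (stmt-NavierStokesRegularity-20428) — AXIS KINEMATICS V: a class slice whose
# vertical velocity is a «Hill-type» quadratic `k ρ² + m` on an open set is excluded (`k ≠ 0`), or flat there (`k = 0`)

Cell ns-regularity-ideate, seat ns-poloidal-K2-p3 gen 5 (LEAD of item 20428; file landed `--supports stmt-NavierStokesRegularity-20428` as a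
helper).  Fifth kernel brick of AXIS-NOTE (step 5): the alternative left by the angular-harmonics lemma (`…AxisKinematics4`) when the centre
moves, `v₂ = k |y_h − c|² + m` on an open set of a plane, is impossible for a profile of the route's Type-I class unless `k = 0`: the slice is
real-analytic on `ℝ³` (tree `analyticOnNhd_slice`), so `v₂` IS that quadratic everywhere on the slice's plane… indeed on all of `ℝ³` as a
function of `y` (identity theorem for `y ↦ v₂(y) − (k ρ²(y) + m)` when the agreement holds on an open subset of `ℝ³`), and a nonzero
quadratic is unbounded, contradicting `‖v(s,y)‖ ≤ C/√(−s)`.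

* `not_bddAbove_quadratic` — `y ↦ |k((y₀−c₀)² + (y₁−c₁)²) + m|` is unbounded on `ℝ³` for `k ≠ 0`;
* `apply_two_eq_quadratic_of_eqOn_open` — identity theorem: agreement of `v₂(s,·)` with the quadratic on a nonempty open set ⇒ everywhere;
* `quadratic_coeff_eq_zero_of_eqOn_open` — **CLASS: if `v₂(s,y) = k ρ²(y) + m` for all `y` in a nonempty open `U ⊆ ℝ³`, then `k = 0`**;
* `horizontalGradient_eq_zero_of_quadratic` — … and then `∇_h v₂ = 0` on `U` (the plane is flat there: the ND clause `∇_h v₂ ≠ 0` fails).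

WHAT THIS IS NOT: not a claim about Navier–Stokes regularity and not the axis lemma — its class-specific exclusion step
(bears_on LADDER-NS N0 via item 20428).
-/

noncomputable section

-- the summit and its single sub-problem share the name (CONVENTIONS §1), as in every Theorems file
set_option linter.dupNamespace false

namespace Summit.NavierStokesRegularity.NavierStokesRegularity.Theorems.PoloidalWindowDoorLrcModEntireAxisKinematics5

open Set Function Filter Topology Metric
open scoped RealInnerProductSpace InnerProductSpace
open Literature.Analysis Literature.Analysis.FluidPDE
open Summit.NavierStokesRegularity.NavierStokesRegularity.Theorems.LocalSineTubeDoorProfileAlignedWindowRigidityAncient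
open Summit.NavierStokesRegularity.NavierStokesRegularity.Theorems.PoloidalWindowDoorPoloidalWindowRigiditySymmetryGerms
open Summit.NavierStokesRegularity.NavierStokesRegularity.Theorems.PoloidalWindowDoorLrcModEntireAxisKinematics

/-! ### A nonzero radial quadratic is unbounded -/

/-- `|k ρ²(y) + m|` is not bounded above on `ℝ³` when `k ≠ 0` (`ρ²(y) = (y₀−c₀)² + (y₁−c₁)²`). -/
theorem not_bddAbove_quadratic {k m : ℝ} (hk : k ≠ 0) (c : EuclideanSpace ℝ (Fin 3)) :
    ¬ BddAbove (Set.range fun y : EuclideanSpace ℝ (Fin 3) => |k * ((y 0 - c 0) ^ 2 + (y 1 - c 1) ^ 2) + m|) := by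
  rintro ⟨B, hB⟩
  -- evaluate at `y = c + t e₀`, `ρ² = t²`: `|k t² + m| ≤ B` for all `t` is absurd
  have hval : ∀ t : ℝ, |k * t ^ 2 + m| ≤ B := by
    intro t
    have h := hB ⟨c + t • EuclideanSpace.single 0 1, rfl⟩
    simpa using h
  -- choose `t² = (B + |m| + 1)/|k|`
  have hkpos : 0 < |k| := abs_pos.2 hk
  set T : ℝ := (B + |m| + 1) / |k| with hT
  have hB0 : 0 ≤ B := le_trans (abs_nonneg _) (hval 0)
  have hTnn : 0 ≤ T := by rw [hT]; positivity
  have h1 := hval (Real.sqrt T)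
  rw [Real.sq_sqrt hTnn] at h1
  have h2 : |k * T| ≤ B + |m| := by
    have := abs_add_le (k * T + m) (-m)
    simp only [add_neg_cancel_right, abs_neg] at this
    linarith
  rw [abs_mul, abs_of_nonneg hTnn, hT, mul_div_cancel₀ _ (ne_of_gt hkpos)] at h2
  linarith

/-! ### Class form -/

section Class

variable {C : ℝ} {v : ℝ → EuclideanSpace ℝ (Fin 3) → EuclideanSpace ℝ (Fin 3)}

/-- **Identity theorem for the quadratic.**  If the vertical velocity of the slice `s < 0` of a profile of the route's Type-I class agrees
with `k ρ² + m` on a nonempty open set, it agrees everywhere. -/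
theorem apply_two_eq_quadratic_of_eqOn_open (hrate : HasTypeITimeDecay C v)
    (hcont : ContinuousOn (uncurry v) (Iio (0 : ℝ) ×ˢ univ))
    (hmild : ∀ s t : ℝ, s < t → t < 0 → ∀ x,
      v t x = UnboundedOperators.heatExtension (v s) (t - s) x - oseenDuhamel 1 s v v t x)
    {s : ℝ} (hs : s < 0) {k m : ℝ} {c : EuclideanSpace ℝ (Fin 3)} {U : Set (EuclideanSpace ℝ (Fin 3))} (hU : IsOpen U)
    (hne : U.Nonempty) (h : ∀ y ∈ U, v s y 2 = k * ((y 0 - c 0) ^ 2 + (y 1 - c 1) ^ 2) + m)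
    (y : EuclideanSpace ℝ (Fin 3)) : v s y 2 = k * ((y 0 - c 0) ^ 2 + (y 1 - c 1) ^ 2) + m := by
  have hA : AnalyticOnNhd ℝ (v s) univ := analyticOnNhd_slice hcont (bdd_of_hasTypeITimeDecay hrate) hmild hs
  have hA2 : AnalyticOnNhd ℝ (fun y => v s y 2) univ := fun y hy =>
    ((EuclideanSpace.proj (2 : Fin 3) : EuclideanSpace ℝ (Fin 3) →L[ℝ] ℝ).analyticAt _).comp (hA y hy)
  have hQ : AnalyticOnNhd ℝ (fun y : EuclideanSpace ℝ (Fin 3) => k * ((y 0 - c 0) ^ 2 + (y 1 - c 1) ^ 2) + m) univ :=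
    ((contDiff_sqDist c).const_smul k |>.add contDiff_const).analyticOnNhd.mono (subset_univ _) |> fun h => by
      simpa [smul_eq_mul] using h
  exact eq_of_eqOn_open hA2 hQ hU hne h y

/-- **CLASS: a Hill-type quadratic vertical velocity on an open set forces `k = 0`.**  For a profile of the route's Type-I class and a
slice `s < 0`: if `v₂(s,y) = k ρ²(y) + m` on a nonempty open `U`, then `k = 0` (else `v₂`, hence `‖v(s,·)‖`, is unbounded on `ℝ³`,
contradicting the Type-I bound). -/
theorem quadratic_coeff_eq_zero_of_eqOn_open (hrate : HasTypeITimeDecay C v)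
    (hcont : ContinuousOn (uncurry v) (Iio (0 : ℝ) ×ˢ univ))
    (hmild : ∀ s t : ℝ, s < t → t < 0 → ∀ x,
      v t x = UnboundedOperators.heatExtension (v s) (t - s) x - oseenDuhamel 1 s v v t x)
    {s : ℝ} (hs : s < 0) {k m : ℝ} {c : EuclideanSpace ℝ (Fin 3)} {U : Set (EuclideanSpace ℝ (Fin 3))} (hU : IsOpen U)
    (hne : U.Nonempty) (h : ∀ y ∈ U, v s y 2 = k * ((y 0 - c 0) ^ 2 + (y 1 - c 1) ^ 2) + m) : k = 0 := by
  by_contra hk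
  apply not_bddAbove_quadratic hk c (m := m)
  refine ⟨C / Real.sqrt (-s), ?_⟩
  rintro _ ⟨y, rfl⟩
  have hall := apply_two_eq_quadratic_of_eqOn_open hrate hcont hmild hs hU hne h y
  have hcoord : |v s y 2| ≤ ‖v s y‖ :=
    Summit.NavierStokesRegularity.NavierStokesRegularity.Theorems.PoloidalWindowDoorPoloidalWindowRigidityConstantShearMeans.abs_apply_le_norm
      (v s y) 2
  have hb := hrate s hs y
  dsimp only
  rw [← hall]
  exact hcoord.trans hb

/-- … hence `v₂(s,·)` is constant and ALL its derivatives vanish, in particular `∂₀v₂ = ∂₁v₂ = 0`: the plane is horizontally FLAT (the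
non-degeneracy clause `∇_h v₂ ≠ 0` of the registered stubs fails there). -/
theorem horizontalGradient_eq_zero_of_quadratic (hrate : HasTypeITimeDecay C v)
    (hcont : ContinuousOn (uncurry v) (Iio (0 : ℝ) ×ˢ univ))
    (hmild : ∀ s t : ℝ, s < t → t < 0 → ∀ x,
      v t x = UnboundedOperators.heatExtension (v s) (t - s) x - oseenDuhamel 1 s v v t x)
    {s : ℝ} (hs : s < 0) {k m : ℝ} {c : EuclideanSpace ℝ (Fin 3)} {U : Set (EuclideanSpace ℝ (Fin 3))} (hU : IsOpen U)
    (hne : U.Nonempty) (h : ∀ y ∈ U, v s y 2 = k * ((y 0 - c 0) ^ 2 + (y 1 - c 1) ^ 2) + m)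
    (y : EuclideanSpace ℝ (Fin 3)) (b : Fin 3) :
    fderiv ℝ (v s) y (EuclideanSpace.single b 1) 2 = 0 := by
  have hk := quadratic_coeff_eq_zero_of_eqOn_open hrate hcont hmild hs hU hne h
  have hall : ∀ y', v s y' 2 = m := fun y' => by
    have := apply_two_eq_quadratic_of_eqOn_open hrate hcont hmild hs hU hne h y'
    simpa [hk] using this
  have hA : AnalyticOnNhd ℝ (v s) univ := analyticOnNhd_slice hcont (bdd_of_hasTypeITimeDecay hrate) hmild hs
  have hd : DifferentiableAt ℝ (v s) y := (hA y (mem_univ y)).differentiableAt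
  rw [← Summit.NavierStokesRegularity.NavierStokesRegularity.Theorems.PoloidalWindowDoorPoloidalWindowRigidityConstantShearMeans.fderiv_coord_apply
    hd 2]
  have hconst : (fun y' => v s y' 2) = fun _ => m := funext hall
  rw [hconst, fderiv_fun_const]
  rfl

end Class

end Summit.NavierStokesRegularity.NavierStokesRegularity.Theorems.PoloidalWindowDoorLrcModEntireAxisKinematics5

end
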